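import Summits.QuantumFields.YangMills.Theorems.BalabanUVNodesN19RateEdgeHolderD4AtRuns
import Summits.QuantumFields.YangMills.Theorems.BalabanUVNodesSpineReadingOfRecord13CoPHV

/-!
# BalabanUVNodes ∕ N19 — K3⁷ v2's N19′ SLOT UNDER THE `ForSmallCouplings` PREFIX AT dag-n20-d's V READING `crOfRecord₁₃VAt K₀ (jc …) sh` (the cut a TUPLE READING `jc`), MODULO THE SHORTEST
# LINK READING SO FAR: the runs PINNED to the runs of record (this seat's `…D4AtRuns`) × the (ii-m) reference ledger ON THE FAMILY's LATTICES (dag-n19-d's K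
# `…D4AtSpineReadingV`) × `0 ≤ S.vol` definitional — v9's clause minus TWENTY conjuncts (J's 8, K's 4, AtRuns' 7, the volume sign)

Cell `pub-ymgap`, HUMAN RULING D-0062 (Track A) + D-0149 (work-bound push, director-ym №197), WIDTH SEAT `pub-ymgap-dag-n19-w3` (N19 NE7, seat 3 of 3),
generation g2; bus INTENT-2.  Route `Summits/QuantumFields/YangMills/Theses/BalabanUVNodes.lean` rev 25, cluster item K3⁷ «SpineGivenEndpointR13SepCoPH»
(stmt-QuantumFields-20544), plan g79's skeleton v2 145a664ea9c38a7b (N19′'s slot `KeyedCoreEdgeHolderD4 β cr (rrOfRecord 𝔯 ksel)`, rates predicate `PHolderD4 β`;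
`PinnedAtLive` names `cr := crOfRecord₁₃(V) jcut sh`; plan g81's v3 note (t-JC), pub-ymgap INBOX l.26065, makes the cut a TUPLE READING `jc F θ hP g₀ os : ℕ → ℕ` — the shape
used here; K's tuple-blind `jcut` is the constant reading); filed `--kind proof --supports` that item `--as helper` (it proves no registered stub).  COUNT-NEUTRAL.
THEOREMS ONLY; 0 `def`; 0 `sorry`; `N`-generic, guard-generic `G`; NO Theses import.  Imports this seat's `…N19RateEdgeHolderD4AtRuns` (INTENT-1: §2
`h19HolderD4_datumOfRecord₁₃CoPH_of_linkReadingAtRuns_tuned`, reading-generic) and dag-n20-d's V edition `…SpineReadingOfRecord13CoPHV` (p590105: `crOfRecord₁₃VAt K₀ jcut sh`,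
`vol := F.side ^ 4`, transfer `core_crOfRecord₁₃VAt`) — CITED BY NAME, none edited; dag-n19-d's K `…D4AtSpineReadingV` (p591223) is the pattern (its (ii-m) edit), not imported.

WHAT THIS FILE PROVES (`S := crOfRecord₁₃VAt K₀ (jc F θ hP g₀ os) sh F θ hP g₀ os`, `R := rateCarriersOfRecord₁₃CoPH 𝔯 F θ hP g₀ os k`, `D := datumOfRecord₁₃CoPH F N θ hP`).
* ★★ `h19HolderD4_crOfRecord₁₃VAt_of_linkReadingAtRuns_tuned` — at every guarded admissible tuple, every bare sequence TUNED within `]0, γ]`, `γ ≤ θ.γ`, with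
  `β ≤ b′` along its runs of record, every `os k`: `PHolderD4 β D R` (spelled out) `→ ∃ δ, NE7.Core S.l₀ S.vol S.T S.Bad (S.A − S.shA) (S.B − S.shB) δ ∧ Summable δ`,
  MODULO `hlink` = this seat's AtRuns clause at `S` with K's (ii-m) pin (`Pf K := F.P (Koff + K)`, `d₀ := 4`, `L₀ := F.L`, NODE O's `cells` on
  `Site (F.P (Koff + K)) j`; four lattice clauses removed) AND `0 ≤ S.vol` removed (`S.vol = F.side ^ 4` by `rfl`, `T4Family.side_pos`).  Proof: INTENT-1's §2 at
  `cr := fun F θ hP g₀ os => crOfRecord₁₃VAt K₀ (jc F θ hP g₀ os) sh F θ hP g₀ os`, its clause REASSEMBLED from this one + `latticeLetters_family F Koff` + the volume sign (staged `obtain`s, one constructor — K's pattern).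
* ★ `core_crOfRecord₁₃VAt_of_linkReadingAtRuns_tuned_of_shellWeightBound` — the same with the reading's OWN canonical rate `S.δ` (sign from any shell witness,
  `core_nonneg_of_shellWeightBound`; transfer `core_crOfRecord₁₃VAt`) — `Summable S.δ` a corollary of the edge (ref-B PIN-N19-DELTAOFRECORD).
* ★★ `forSmallCouplings_h19HolderD4_crOfRecord₁₃VAt_of_linkReadingAtRuns` — UNDER THE CRUX's PREFIX BY NAME from K1⁷'s interval-form window
  `BetaBoundsInInterval D.C.toB12 γ₀ b b′` (threshold `min γ₀ θ.γ`; this seat's g0 `betaAlong_runFlow_le_of_betaBoundsInInterval`) · ★ `…_keyed (ks)` — v2's slot text at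
  the V reading under the prefix, unfolded (`K₀ := 0`, constant `jc` is K's `crOfRecord₁₃V jcut sh`).
N19's displayed residual AT THE V READING UNDER THE PREFIX: NODE O's ledger world (i)∕(ii-m: `kappa₀ 64 8 ≤ R.u3.κ` + three `cells` clauses)∕(ii-v-A∕B)∕(ii-d) READ
AT THE RUNS OF RECORD, [III] Thm 2 (2.43) letters (N11), N14's positional count, the (v′-16) N16 ∕ N07 letters of `𝔯.lit`, `EventualLowerH` ∕ smallness ∕ `0 < ρ ≤ θc`,
(T)'s `DecayBound` ∕ pair discs ∕ constants, the selector, `θ.γ² ≤ e⁻¹`.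

HONEST FRAMING.  Count-neutral kernel bookkeeping; `hlink` is a HYPOTHESIS (NODE O's world; 0 instances in the tree); `D.Tuned` (K2⁷ ∕ [B12] Thm 2 content) and
`BetaBoundsInInterval` (K1⁷'s β-window; [Balaban1987RG1] (1.22) p. 264 upper half, proof deferred in print; lower half UNPRINTED) are HYPOTHESES; the shell witness `hsh`
a HYPOTHESIS; `K₀ jc sh 𝔯 G ks` PARAMETERS (`sh` NOT inhabited — NODE O ∕ N21).  NOT a proof of `stub_expansion13H`; no skeleton text touched, no v3 proposed.  NE7 for
Bałaban's two runs is NOT PRINTED and NOT proved; nothing of Bałaban's is asserted or instantiated (K0⁷ OPEN); N19 NOT discharged; K3⁷ NOT claimed; Track A count unmoved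
(typed 28∕28 · discharged 5∕27 · A 5∕28).  One finite four-torus at fixed ε, rung (B)+1 — R4 closes the CONDITIONAL finite-𝕋⁴ rung `BalabanLadder.UV` only; NOT infinite
volume, NOT OS on ℝ⁴, NOT a mass gap; the YM mass gap (Clay) is NOT proved by any of this.  Standard axioms.  Supersedes nothing; edits nothing.  Shape reference:
[Balaban1987RG1] Thm 2 p. 259 (the NAME of the hypothesis `D.Tuned` — nothing asserted).
-/

set_option autoImplicit false

noncomputable section

open Finset MeasureTheory
open scoped BigOperators Matrix Matrix.Norms.L2Operator

namespace Summit.QuantumFields.YangMills.BalabanUVNodes.N19RateEdgeHolderD4AtRunsV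

open Literature.MathematicalPhysics.QuantumFieldTheory.Balaban1983to89
open T4OutputRate T4RecentScale T4GoodClassBudget T4CauchySum T4TowerRateComposition T4TowerRateDischarge
open T4EtaRateMin (Readings NE3Shape)
open T4RateLiaison (GaugeDominated)
open T4CouplingMatching (EventualLowerH)
open FlowStep (RGEqH prefixOf)
open TreeLengthTorus (TFaceConnected torusTreeLen)
open B12TreeDecay (kappa₀)
open Summit.QuantumFields.BalabanUV.T4Continuum
open AveragingDeficitDualResidual (dualC1 dualC2)
open AveragingDeficitDerivWallProof (wallConst)
open AveragingDeficitPeriodicCounting (IsPeriodicDir)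
open MinimalActionSandwich (IsMinimiser minAct)
open MinimalActionRate (sfClass)
open MinimalActionRefine (RegularSup gradConst)
open NE3EnergyShapes (IsUnitarySite IsPeriodicSite)
open NE3.LeafIndexSockets (LeafH3sup)
open Summit.QuantumFields.BalabanUV.T4Continuum.Spine
open Summit.QuantumFields.BalabanUV.T4Continuum.Spine.NE4 (runFlow)
open Summit.QuantumFields.BalabanUV.T4Continuum.NE1p.DressedRoot (DressedTower DressedStabilityStrict)
open Summit.QuantumFields.YangMills.BalabanUVNodes.N19LedgerLinkSync (LedgerDataSync LedgerAtSync)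
open YMDAG.UVSplit (SpineCarriers SpineRecordPred InputsPred U3Carriers RateCarriers RateRecordPred N14At N18At N22At ReadOutAt)
open Summit.QuantumFields.YangMills.BalabanUVNodes.N16HolderDefs (CovRootHolder N16HolderAt)
open Summit.QuantumFields.YangMills.BalabanUVNodes.SpineRatesHolder (RatesHolderAt)
open Literature.MathematicalPhysics.QuantumFieldTheory.Balaban1983to89.T4Continuum (T4Family ULoop)
open T4WeightBudget (RelWeightBound)
open T4IndicatorShell (ShellWeightBound)
open T4ContinuumYM4Torus (ForSmallCouplings)
open YMDAG.UVSplit (Datum RateReading₁₃CoPH rateCarriersOfRecord₁₃CoPH)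
open YMDAG.UVSplit (SpineReading₁₃CoPH ShellSplit₁₃CoPH crOfRecord₁₃VAt classSet₁₃ weightA₁₃ weightB₁₃ badClass₁₃ core_crOfRecord₁₃VAt)
open Node00 (Stage13HParams datumOfRecord₁₃CoPH SiteSeqKey)
open Summit.QuantumFields.YangMills.BalabanUVNodes.SpineCanonicalWeights (core_nonneg_of_shellWeightBound)
open Summit.QuantumFields.YangMills.BalabanUVNodes.N19RateEdgeRecordRunLetters (latticeLetters_family)
open Summit.QuantumFields.YangMills.BalabanUVNodes.N19RateEdgeRecordRunLettersTuned (betaAlong_runFlow_le_of_betaBoundsInInterval)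
open Summit.QuantumFields.YangMills.BalabanUVNodes.N19RateEdgeHolderD4AtRuns (h19HolderD4_datumOfRecord₁₃CoPH_of_linkReadingAtRuns_tuned)

/-! ## §1 The link reading AT THE RUNS OF RECORD, AT THE V READING, on tuned bare sequences ⇒ N19′'s edge GIVEN `PHolderD4 β` -/

section AtRunsV

variable {N : ℕ} [NeZero N] (K₀ : ℕ)
  (jc : (F : T4Family) → (θ : Stage13HParams F N) → θ.Provisos₁₃CoPH F N → (ℕ → ℝ) → List (ULoop F) → ℕ → ℕ) (sh : ShellSplit₁₃CoPH N K₀)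
  (𝔯 : RateReading₁₃CoPH N) (G : ∀ {F : T4Family}, Stage13HParams F N → Prop) {β : ℝ} (hβ1 : β ≤ 1)
  (hlink : ∀ (F : T4Family) (θ : Stage13HParams F N) (hP : θ.Provisos₁₃CoPH F N), G θ → θ.Admissible F N →
    ∀ (γ gIR : ℝ) (g₀ : ℕ → ℝ), (datumOfRecord₁₃CoPH F N θ hP).Tuned γ gIR g₀ → γ ≤ θ.γ →
    ∀ (os : List (ULoop F)) (k : ℕ),
      let S : SpineCarriers := crOfRecord₁₃VAt K₀ (jc F θ hP g₀ os) sh F θ hP g₀ os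
      let R : RateCarriers N := rateCarriersOfRecord₁₃CoPH 𝔯 F θ hP g₀ os k
      let D : Datum F N := datumOfRecord₁₃CoPH F N θ hP
      letI := S.dec
      -- the tuple's window letter (replaces (T)'s clause over `R.u3.W`; dag-n19-w3 `window_rateCarriersOfRecord₁₃CoPH_sq_le_exp_neg_one`)
      θ.γ ^ 2 ≤ Real.exp (-1) ∧
      ∃ (_ : DecidableEq R.u3.C.Dom) (F' : Type) (ι' X' : Type) (_ : MeasurableSpace ι')
        (L : LedgerDataSync R.u3.C F' ι' S.ι) (Rd : Readings ι' X') (bsel : (ℕ → ℝ) → ℝ) (EB : Functional R.u3.C R.u3.C.BgB)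
        (θc θ₃ : ℝ) (g : ℕ → ℕ → ℝ)
        (uA : ℕ → ι' → R.u3.C.BgA) (uB : ℕ → ι' → R.u3.C.BgB)
        (Koff : ℕ) (cells : (K j : ℕ) → R.u3.C.Dom → Finset (Site (F.P (Koff + K)) j))
        (H033 : Flow → ℕ → Prop) (I : Type) (fam : I → B14.Sect2Data) (Lb βw : ℝ) (κ₁ : ℕ) (Gv Cl : ℝ) (K₁ : ℕ)
        (Λ₀ N₀ : ℝ) (dressed : R.u3.C.Dom → Prop) (_ : DecidablePred dressed)
        -- N16-side letters: regime, selection, reading map, NE7 route-#1 side letters, offset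
        (c' t ε₁ θ γ₃ l₁ : ℝ)
        (sel : ℕ → (B7Prop1Explicit.Site 4 → Fin 4 → (Matrix (Fin N) (Fin N) ℂ)ˣ) → (B7Prop1Explicit.Site 4 → Fin 4 → (Matrix (Fin N) (Fin N) ℂ)ˣ))
        (rd : ι' → (B7Prop1Explicit.Site 4 → Fin 4 → (Matrix (Fin N) (Fin N) ℂ)ˣ)) (k₀ : ℕ)
        -- N17-side letters: β-window (the infrared pin `gIR` is the TUNED value, no longer a binder)
        (bβ : ℝ) (k₀β : ℕ)
        -- TUBE letters of the bracket (T): the (1.18) constant, the layer factor and (2.28)'s `C₁, q₁` (the flow's `β′_T` is no longer a binder)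
        (E₀T κ₁T C₁T : ℝ) (q₁ : ℕ),
        -- ★ THE RUNS OF RECORD, window-extended by the infrared value: `g` IS `runFlow D g₀ K` up to the cutoff and `gIR` beyond (replaces the
        -- (0.20)-run identification, the infrared pin, the box, both window memberships, (T)'s upper running and its sign `0 ≤ β′_T`)
        (∀ K i, i ≤ K → g K i = runFlow D g₀ K i) ∧ (∀ K i, K < i → g K i = gIR) ∧
        -- the run-B functional is the first-coupling family read through the selector
        EB = (fun s => R.u3.EB (bsel s) s) ∧
        -- (i) the ledger predicate for whatever size data and census constants meet their clauses
        (∀ (Sz : ℕ → ℝ → S.ι → ℕ → ℝ) (E₀ : ℝ) (m : ℕ) (a : ℝ) (Cw Λg : ℝ),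
          (∀ K t, |t| ≤ S.l₀ → ∀ τ ∈ S.T K \ S.Bad K t, ∀ v ∈ Rd.dom, ∀ j ≤ K,
            |∑ X ∈ L.fac K t τ with R.u3.C.scale X = j,
                (Real.log (Real.exp (EB (fun i => g (K + 1) (i + 1)) (uB K v) X
                    - EB (fun i => g (K + 1) (i + 1)) L.oneB X))
                  - Real.log (Real.exp (R.u3.EA (g K) (uA K v) X - R.u3.EA (g K) L.oneA X)))| ≤ Sz K t τ j) →
          0 ≤ E₀ → 0 < a → a < 1 →
          (∀ K t, |t| ≤ S.l₀ → ∀ τ ∈ S.T K \ S.Bad K t, ∀ j ≤ K,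
            Sz K t τ j ≤ S.vol * (E₀ * ((K : ℝ) + 1) ^ m * a ^ (K - j))) →
          (∀ K, Multiplicity (L.All K) R.u3.C.scale (fun X => Real.exp (-(R.u3.κ * R.u3.C.d X))) Cw S.vol Λg K) →
          (∀ K t, |t| ≤ S.l₀ → ∀ τ ∈ S.T K \ S.Bad K t,
            WindowMultiplicity (L.facO K t τ) L.scO L.wO Cw S.vol Λg (jlogOf L.Cl K) K) →
          1 ≤ Λg → L.θ' ≤ Λg →
          LedgerAtSync { L with S := Sz, E₀ := E₀, m := m, a := a, Cw := Cw, Λg := Λg } S.l₀ S.vol S.T S.Bad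
            (fun K t τ => S.A K t τ - S.shA K t τ) (fun K t τ => S.B K t τ - S.shB K t τ) Rd R.u3.EA EB R.u3.κ g uA uB
            R.u3.ω θc R.u3.θ θ₃) ∧
        -- (`0 ≤ S.vol` dropped: `S.vol = F.side ^ 4` by `rfl` at the V reading)
        (∀ K t, |t| ≤ S.l₀ → ∀ τ ∈ S.T K \ S.Bad K t,
          WindowMultiplicity (L.facO K t τ) L.scO L.wO L.Cw S.vol L.Λg (jlogOf L.Cl K) K) ∧
        0 ≤ L.Cw ∧ 1 ≤ L.Λg ∧ L.θ' ≤ L.Λg ∧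
        -- (ii-m) the reference ledger ON THE FAMILY's OWN LATTICES (dag-n19-d's K: `Pf K := F.P (Koff + K)`, `d₀ := 4`, `L₀ := F.L`; the four lattice
        -- clauses are `latticeLetters_family F Koff` at `S.vol = F.side ^ 4`): the decay threshold and NODE O's three `cells` clauses remain
        kappa₀ (4 * 2 ^ 4) (2 * 4) ≤ R.u3.κ ∧
        (∀ K, ∀ X ∈ L.All K,
          (cells K (R.u3.C.scale X + Koff) X).Nonempty ∧ TFaceConnected (cells K (R.u3.C.scale X + Koff) X)) ∧
        (∀ K j, Set.InjOn (cells K j) ↑((L.All K).filter fun X => R.u3.C.scale X + Koff = j)) ∧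
        (∀ K, ∀ X ∈ L.All K, torusTreeLen (cells K (R.u3.C.scale X + Koff) X) ≤ R.u3.C.d X) ∧
        -- (iii) [III] Theorem 2 (2.43) AS PRINTED with window letters
        B14.Thm2Printed H033 fam Lb βw κ₁ ∧ βw < 1 ∧ 0 < βw ∧ 1 < Lb ∧ 1 ≤ Gv ∧ 0 ≤ Cl ∧
        -- (iv) the positional-count half of N14's pinned pair at a rate `≤ R.ne1.Λ`
        (∀ p K, (R.ne1.𝒯.B p K).PositionalCount fun j k => N₀ * Λ₀ ^ (k - j)) ∧ 0 ≤ N₀ ∧ 0 ≤ Λ₀ ∧ Λ₀ ≤ R.ne1.Λ ∧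
        -- (ii-v-A) run A's vacuum slices ↔ printed E-terms
        (∀ K t, |t| ≤ S.l₀ → ∀ τ ∈ S.T K \ S.Bad K t, ∀ v ∈ Rd.dom, ∀ j ≤ K, ∃ (i : I) (w : (fam i).Ω) (j' : ℕ),
          (fam i).flow.SatisfiesRG (fam i).K ∧ H033 (fam i).flow (fam i).K ∧ 1 ≤ j' ∧ j' ≤ (fam i).K ∧
          (fam i).K - j' = K - j ∧ (fam i).K ≤ K + K₁ ∧
          (∀ n, 0 ≤ (fam i).gammaVol n w) ∧ (fam i).gammaVol (fam i).K w ≤ S.vol ∧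
          (∀ n, n < (fam i).K → n < jlogOf Cl (fam i).K → (fam i).gammaVol n w = 0) ∧
          (∀ n, n < (fam i).K → jlogOf Cl (fam i).K ≤ n → (fam i).gammaVol n w ≤ S.vol * Gv ^ ((fam i).K - n)) ∧
          |∑ X ∈ (L.fac K t τ).filter (fun X => ¬ dressed X) with R.u3.C.scale X = j,
              (R.u3.EA (g K) (uA K v) X - R.u3.EA (g K) L.oneA X)| ≤ |(fam i).eTerm j' (fam i).K w|) ∧
        -- (ii-v-B) run B's vacuum slices ↔ printed E-terms
        (∀ K t, |t| ≤ S.l₀ → ∀ τ ∈ S.T K \ S.Bad K t, ∀ v ∈ Rd.dom, ∀ j ≤ K, ∃ (i : I) (w : (fam i).Ω) (j' : ℕ),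
          (fam i).flow.SatisfiesRG (fam i).K ∧ H033 (fam i).flow (fam i).K ∧ 1 ≤ j' ∧ j' ≤ (fam i).K ∧
          (fam i).K - j' = K - j ∧ (fam i).K ≤ K + K₁ ∧
          (∀ n, 0 ≤ (fam i).gammaVol n w) ∧ (fam i).gammaVol (fam i).K w ≤ S.vol ∧
          (∀ n, n < (fam i).K → n < jlogOf Cl (fam i).K → (fam i).gammaVol n w = 0) ∧
          (∀ n, n < (fam i).K → jlogOf Cl (fam i).K ≤ n → (fam i).gammaVol n w ≤ S.vol * Gv ^ ((fam i).K - n)) ∧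
          |∑ X ∈ (L.fac K t τ).filter (fun X => ¬ dressed X) with R.u3.C.scale X = j,
              (EB (fun i => g (K + 1) (i + 1)) (uB K v) X - EB (fun i => g (K + 1) (i + 1)) L.oneB X)|
            ≤ |(fam i).eTerm j' (fam i).K w|) ∧
        -- (ii-d) the dressed sub-ledger ↔ N14's bookings on `R.ne1.𝒯`
        (∀ K t, |t| ≤ S.l₀ → ∀ τ ∈ S.T K \ S.Bad K t, ∀ v ∈ Rd.dom,
          ∃ (pA : R.ne1.P) (βA : R.u3.C.Dom → (R.ne1.𝒯.B pA K).Birth) (Q : Finset (R.ne1.𝒯.B pA K).Cube) (pB : R.ne1.P)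
            (KB : ℕ) (βB : R.u3.C.Dom → (R.ne1.𝒯.B pB KB).Birth),
          (∀ X ∈ (L.fac K t τ).filter (fun X => dressed X), (R.ne1.𝒯.B pA K).birthScale (βA X) = R.u3.C.scale X) ∧
          (∀ j, Set.InjOn βA ↑(((L.fac K t τ).filter (fun X => dressed X)).filter fun X => R.u3.C.scale X = j)) ∧
          (∀ c ∈ Q, (R.ne1.𝒯.B pA K).cubeScale c = K) ∧ ((Q.card : ℝ) ≤ S.vol) ∧
          (∀ X ∈ (L.fac K t τ).filter (fun X => dressed X), ∃ c ∈ Q, βA X ∈ (R.ne1.𝒯.B pA K).feltAt c) ∧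
          (∀ X ∈ (L.fac K t τ).filter (fun X => dressed X), KB - (R.ne1.𝒯.B pB KB).birthScale (βB X) = K - R.u3.C.scale X) ∧
          (∀ X ∈ (L.fac K t τ).filter (fun X => dressed X),
            |R.u3.EA (g K) (uA K v) X - R.u3.EA (g K) L.oneA X| ≤ (R.ne1.𝒯.B pA K).size (βA X) K) ∧
          (∀ X ∈ (L.fac K t τ).filter (fun X => dressed X),
            |EB (fun i => g (K + 1) (i + 1)) (uB K v) X - EB (fun i => g (K + 1) (i + 1)) L.oneB X|
              ≤ (R.ne1.𝒯.B pB KB).size (βB X) KB)) ∧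
        -- (v′-16) N16 BY NAME: THE END's regime letters of `R.ne3`, N07's interface, the selection, NE7 route-#1's side letters, the
        -- reading map, the action-reading identification, the offset, the gauge-domination convention
        R.ne3.g = gradConst 4 c' ∧ 1 ≤ R.ne3.Nper ∧ 0 ≤ R.ne3.b ∧ 0 ≤ c' ∧ R.ne3.b ≤ t ∧ c' ≤ t ∧ 0 ≤ R.ne3.C ∧
        (2 : ℝ) ^ 91 * (R.ne3.L : ℝ) ^ 17 * t ≤ 1 ∧ (2 : ℝ) ^ 76 * (R.ne3.L : ℝ) ^ 12 * t ≤ R.ne3.ε ∧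
        16 * B7Prop2Explicit.C0 4 * R.ne3.ε ≤ 3 ∧ 1024 * (4 + 1) * (4 + 4) * (R.ne3.L : ℝ) ^ 2 * R.ne3.ε ≤ 1 ∧
        ε₁ ≤ 1 / 4 ∧ ε₁ ≤ R.ne3.b ∧ 4 * ε₁ ≤ c' ∧ R.ne3.dom ⊆ sfClass 4 R.ne3.L R.ne3.Nper ε₁ 0 ∧
        LeafH3sup 4 R.ne3.L R.ne3.Nper R.ne3.ε R.ne3.b c' R.ne3.dom ∧
        (∀ V ∈ R.ne3.dom, ∀ k : ℕ, IsMinimiser 4 (sfClass 4 R.ne3.L R.ne3.Nper R.ne3.ε) R.ne3.L R.ne3.Nper k V (sel k V)) ∧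
        (∀ V ∈ R.ne3.dom, ∀ k : ℕ, RegularSup 4 R.ne3.L R.ne3.Nper R.ne3.b c' k (sel k V)) ∧
        0 < θ ∧ θ ^ 6 = ((R.ne3.L : ℝ))⁻¹ ∧ 0 < R.ne3.Λ₂' ∧ 0 < γ₃ ∧
        R.ne3.C * (wallConst 4 R.ne3.L * (R.ne3.Nper : ℝ) ^ 2 *
          (Real.sqrt (gradConst 4 c') * dualC2 4 R.ne3.L + 2 * R.ne3.b ^ 2 * dualC1 4 R.ne3.L)) ≤ γ₃ ^ 3 ∧
        0 < l₁ ∧ R.ne3.Λ₁ ≤ l₁ ^ 3 ∧ γ₃ * θ ^ 2 ≤ l₁ * R.ne3.Nper ∧ θ ^ ((3 : ℝ) * β - 2) ≤ θ₃ ∧ θ₃ < 1 ∧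
        (∀ v ∈ Rd.dom, rd v ∈ R.ne3.dom) ∧
        (∀ k, ∀ v ∈ Rd.dom, Rd.act k v = minAct 4 (sfClass 4 R.ne3.L R.ne3.Nper R.ne3.ε) R.ne3.L R.ne3.Nper k (rd v)) ∧
        (R.ne3.Nper : ℝ) ^ 4 ≤ Rd.vol ∧ 1 ≤ k₀ ∧
        (∀ K : ℕ, ∀ v ∈ Rd.dom, ∀ (u : B7Prop1Explicit.Site 4 → (Matrix (Fin N) (Fin N) ℂ)ˣ)
          (Z : B7Prop1Explicit.Site 4 → Fin 4 → Matrix (Fin N) (Fin N) ℂ) (M : ℝ),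
          IsUnitarySite u → IsPeriodicSite u ((R.ne3.Nper * R.ne3.L ^ (k₀ + K) : ℕ) : ℤ) → T4AveragingDeficitWall.IsSkewDir Z →
          IsPeriodicDir Z ((R.ne3.Nper * R.ne3.L ^ (k₀ + K) : ℕ) : ℤ) →
          B7Prop1Explicit.gaugeAct u (sel (k₀ + K) (rd v)) =
            T4AveragingDeficitWall.vary (B7Prop2Explicit.rescale R.ne3.L (B7Prop1Explicit.bavg R.ne3.L (sel (k₀ + K + 1) (rd v)))) Z 1 →
          (∀ (x : B7Prop1Explicit.Site 4) (κ : Fin 4), (R.ne3.L : ℝ) ^ (k₀ + K) * ‖Z x κ‖ ≤ M) →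
          (∀ (x : B7Prop1Explicit.Site 4) (μ κ : Fin 4), ((R.ne3.L : ℝ) ^ (k₀ + K)) ^ 2 *
              ‖T4AveragingDeficitWall.Ad (B7Prop2Explicit.rescale R.ne3.L (B7Prop1Explicit.bavg R.ne3.L (sel (k₀ + K + 1) (rd v)))
                  (x + B7Prop1Explicit.e κ) μ) (Z (x + B7Prop1Explicit.e μ) κ) - Z x κ‖ ≤ M) →
          R.u3.C.gauge (uA K v) (R.u3.C.transport (uB K v)) ≤ M) ∧
        -- (v′-17) N17 BY NAME, what is left of it: the β-window, the smallness window, rates (run identification ∕ infrared pin ∕ box are the pin's)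
        0 < bβ ∧ EventualLowerH bβ R.u3.γ k₀β D.βfun ∧
        R.u3.cr * R.u3.C₉ * R.u3.ω * (((k₀β : ℝ) + 1) * R.u3.γ ^ 3 + 2 * R.u3.γ / bβ) ≤ (1 - R.u3.ρ) / 2 ∧
        0 < R.u3.ρ ∧ R.u3.ρ ≤ θc ∧
        -- the bracket (T) IN THE TUBE CURRENCY, what is left of it: the (1.18) real bound; the pair-disc shape at the printed tube radius κ₁·α(C₁, q₁, s_j)
        -- ((2.27)(ii)(iv) through the (1.13)∕(2.39) tube — SHAPE, NODE O); signs (the upper running and both window memberships are the pin's)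
        DecayBound R.u3.EA R.u3.W E₀T R.u3.κ ∧
        (∀ s ∈ R.u3.W, ∀ (X : R.u3.C.Dom) (U U' : R.u3.C.BgA),
          R.u3.C.gauge U U' < κ₁T * B14.alphaJ C₁T q₁ (s (R.u3.C.scale X)) →
          ∃ f : ℂ → ℂ, DifferentiableOn ℂ f (Metric.ball (0 : ℂ) (κ₁T * B14.alphaJ C₁T q₁ (s (R.u3.C.scale X)))) ∧
            f 0 = (R.u3.EA s U X : ℂ) ∧ f (R.u3.C.gauge U U' : ℂ) = (R.u3.EA s U' X : ℂ) ∧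
            ∀ z ∈ Metric.ball (0 : ℂ) (κ₁T * B14.alphaJ C₁T q₁ (s (R.u3.C.scale X))),
              ‖f z‖ ≤ E₀T * Real.exp (-(R.u3.κ * R.u3.C.d X))) ∧
        0 ≤ E₀T ∧ 0 < κ₁T ∧ 0 < C₁T ∧
        -- selector compatibility
        (∀ s ∈ R.u3.W, 0 < bsel s ∧ bsel s ≤ R.u3.γ))


include hβ1 hlink

/-- ★★ **N19′'s EDGE AT THE V READING, ON TUNED BARE SEQUENCES, MODULO THE SHORTEST LINK READING SO FAR** [bookkeeping]: at every guarded admissible Stage-13 tuple, every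
bare sequence `g₀` TUNED to `gIR` within `]0, γ]`, `γ ≤ θ.γ` (HYPOTHESIS, [Balaban1987RG1] Thm 2 p. 259's condition at the datum of record), with `β ≤ b′` ALONG ITS RUNS OF RECORD
(K1⁷'s window; HYPOTHESIS), every `os`, `k`: `PHolderD4 β D R` (spelled out) `→ ∃ δ, NE7.Core S.l₀ S.vol S.T S.Bad (S.A − S.shA) (S.B − S.shB) δ ∧ Summable δ` for
`S := crOfRecord₁₃VAt K₀ (jc F θ hP g₀ os) sh F θ hP g₀ os`.  Proof: this seat's AtRuns §2 at `cr := fun F θ hP g₀ os => crOfRecord₁₃VAt K₀ (jc F θ hP g₀ os) sh F θ hP g₀ os`, its clause REASSEMBLED from `hlink` + the four lattice facts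
`latticeLetters_family F Koff` (dag-n19-d's K pattern) + the volume sign `0 ≤ F.side ^ 4`.  NOT NE7; N19 NOT discharged; `hlink` DISPLAYED. -/
theorem h19HolderD4_crOfRecord₁₃VAt_of_linkReadingAtRuns_tuned
    (F : T4Family) (θ : Stage13HParams F N) (hP : θ.Provisos₁₃CoPH F N) (hG : G θ) (hθ : θ.Admissible F N) {γ gIR b' : ℝ} {g₀ : ℕ → ℝ}
    (ht : (datumOfRecord₁₃CoPH F N θ hP).Tuned γ gIR g₀) (hγle : γ ≤ θ.γ)
    (halong : ∀ K i, i < K →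
      (datumOfRecord₁₃CoPH F N θ hP).βfun i (prefixOf (runFlow (datumOfRecord₁₃CoPH F N θ hP) g₀ K) i) ≤ b')
    (os : List (ULoop F)) (k : ℕ)
    (hP4 : RatesHolderAt (datumOfRecord₁₃CoPH F N θ hP) (rateCarriersOfRecord₁₃CoPH 𝔯 F θ hP g₀ os k) β ∧
      ReadOutAt (datumOfRecord₁₃CoPH F N θ hP) (rateCarriersOfRecord₁₃CoPH 𝔯 F θ hP g₀ os k).u3 ∧
      (0 ≤ (rateCarriersOfRecord₁₃CoPH 𝔯 F θ hP g₀ os k).u3.ρ ∧ (rateCarriersOfRecord₁₃CoPH 𝔯 F θ hP g₀ os k).u3.ρ < 1)) :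
    letI := (crOfRecord₁₃VAt K₀ (jc F θ hP g₀ os) sh F θ hP g₀ os).dec
    ∃ δ : ℕ → ℝ, NE7.Core (crOfRecord₁₃VAt K₀ (jc F θ hP g₀ os) sh F θ hP g₀ os).l₀ (crOfRecord₁₃VAt K₀ (jc F θ hP g₀ os) sh F θ hP g₀ os).vol (crOfRecord₁₃VAt K₀ (jc F θ hP g₀ os) sh F θ hP g₀ os).T
      (crOfRecord₁₃VAt K₀ (jc F θ hP g₀ os) sh F θ hP g₀ os).Bad
      (fun K t τ => (crOfRecord₁₃VAt K₀ (jc F θ hP g₀ os) sh F θ hP g₀ os).A K t τ - (crOfRecord₁₃VAt K₀ (jc F θ hP g₀ os) sh F θ hP g₀ os).shA K t τ)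
      (fun K t τ => (crOfRecord₁₃VAt K₀ (jc F θ hP g₀ os) sh F θ hP g₀ os).B K t τ - (crOfRecord₁₃VAt K₀ (jc F θ hP g₀ os) sh F θ hP g₀ os).shB K t τ) δ ∧
      Summable δ := by
  refine h19HolderD4_datumOfRecord₁₃CoPH_of_linkReadingAtRuns_tuned (fun F θ hP g₀ os => crOfRecord₁₃VAt K₀ (jc F θ hP g₀ os) sh F θ hP g₀ os) 𝔯 G hβ1 ?_
    F θ hP hG hθ ht hγle halong os k hP4
  intro F θ hP hG hθ γ gIR g₀ ht hγle os k
  -- destructure this file's reading IN STAGES, then reassemble the AtRuns clause with the (ii-m) letters pinned to the family and the volume sign supplied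
  obtain ⟨hγe, iDom, F', ι', X', iMeas, L, Rd, bsel, EB, θc, θ₃, g, uA, uB, hrest⟩ := hlink F θ hP hG hθ γ gIR g₀ ht hγle os k
  obtain ⟨Koff, cells, H033, I, fam, Lb, βw, κ₁, Gv, Cl, K₁, Λ₀, N₀, dressed, iDr, hrest⟩ := hrest
  obtain ⟨c', t, ε₁, ϑ, γ₃, l₁, sel, rd, k₀, bβ, k₀β, E₀T, κ₁T, C₁T, q₁, hrest⟩ := hrest
  obtain ⟨hgle, hggt, hEB, hL, homult, hCw, hΛg, hθΛ, hκ₀, hdom, hinj, hlen, hrest⟩ := hrest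
  obtain ⟨hPd, hPL, hPK, hcard⟩ := latticeLetters_family F Koff
  have hvol : (0 : ℝ) ≤ (crOfRecord₁₃VAt K₀ (jc F θ hP g₀ os) sh F θ hP g₀ os).vol := pow_nonneg F.side_pos.le 4
  exact ⟨hγe, iDom, F', ι', X', iMeas, L, Rd, bsel, EB, θc, θ₃, g, uA, uB, fun K => F.P (Koff + K), 4, F.L, Koff, cells, H033, I, fam, Lb, βw, κ₁, Gv, Cl, K₁,
    Λ₀, N₀, dressed, iDr, c', t, ε₁, ϑ, γ₃, l₁, sel, rd, k₀, bβ, k₀β, E₀T, κ₁T, C₁T, q₁, hgle, hggt, hEB, hL, hvol, homult, hCw, hΛg, hθΛ, hPd, hPL, hPK,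
    hcard, hκ₀, hdom, hinj, hlen, hrest⟩

/-- ★ **… WITH THE READING's OWN CANONICAL RATE** (sign from any shell witness — dag-n20-d `core_nonneg_of_shellWeightBound`, transfer `core_crOfRecord₁₃VAt`):
`NE7.Core S.l₀ S.vol S.T S.Bad (S.A − S.shA) (S.B − S.shB) S.δ ∧ Summable S.δ` on tuned bare sequences; `Summable S.δ` a COROLLARY of the edge (ref-B PIN-N19-DELTAOFRECORD). [folklore] -/
theorem core_crOfRecord₁₃VAt_of_linkReadingAtRuns_tuned_of_shellWeightBound
    (F : T4Family) (θ : Stage13HParams F N) (hP : θ.Provisos₁₃CoPH F N) (hG : G θ) (hθ : θ.Admissible F N) {γ gIR b' : ℝ} {g₀ : ℕ → ℝ}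
    (ht : (datumOfRecord₁₃CoPH F N θ hP).Tuned γ gIR g₀) (hγle : γ ≤ θ.γ)
    (halong : ∀ K i, i < K →
      (datumOfRecord₁₃CoPH F N θ hP).βfun i (prefixOf (runFlow (datumOfRecord₁₃CoPH F N θ hP) g₀ K) i) ≤ b')
    (os : List (ULoop F)) (k : ℕ)
    (hP4 : RatesHolderAt (datumOfRecord₁₃CoPH F N θ hP) (rateCarriersOfRecord₁₃CoPH 𝔯 F θ hP g₀ os k) β ∧
      ReadOutAt (datumOfRecord₁₃CoPH F N θ hP) (rateCarriersOfRecord₁₃CoPH 𝔯 F θ hP g₀ os k).u3 ∧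
      (0 ≤ (rateCarriersOfRecord₁₃CoPH 𝔯 F θ hP g₀ os k).u3.ρ ∧ (rateCarriersOfRecord₁₃CoPH 𝔯 F θ hP g₀ os k).u3.ρ < 1)) {Wsh : ℕ → ℝ}
    (hsh : ShellWeightBound 1 (classSet₁₃ θ K₀ g₀) (weightA₁₃ θ hP K₀ g₀ os) (weightB₁₃ θ hP K₀ g₀ os) (sh F θ hP g₀ os).1 (sh F θ hP g₀ os).2 Wsh) :
    (letI := (crOfRecord₁₃VAt K₀ (jc F θ hP g₀ os) sh F θ hP g₀ os).dec
     NE7.Core (crOfRecord₁₃VAt K₀ (jc F θ hP g₀ os) sh F θ hP g₀ os).l₀ (crOfRecord₁₃VAt K₀ (jc F θ hP g₀ os) sh F θ hP g₀ os).vol (crOfRecord₁₃VAt K₀ (jc F θ hP g₀ os) sh F θ hP g₀ os).T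
       (crOfRecord₁₃VAt K₀ (jc F θ hP g₀ os) sh F θ hP g₀ os).Bad
       (fun K t τ => (crOfRecord₁₃VAt K₀ (jc F θ hP g₀ os) sh F θ hP g₀ os).A K t τ - (crOfRecord₁₃VAt K₀ (jc F θ hP g₀ os) sh F θ hP g₀ os).shA K t τ)
       (fun K t τ => (crOfRecord₁₃VAt K₀ (jc F θ hP g₀ os) sh F θ hP g₀ os).B K t τ - (crOfRecord₁₃VAt K₀ (jc F θ hP g₀ os) sh F θ hP g₀ os).shB K t τ)
       (crOfRecord₁₃VAt K₀ (jc F θ hP g₀ os) sh F θ hP g₀ os).δ) ∧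
      Summable (crOfRecord₁₃VAt K₀ (jc F θ hP g₀ os) sh F θ hP g₀ os).δ := by
  obtain ⟨δ, hcore, hsum⟩ :=
    h19HolderD4_crOfRecord₁₃VAt_of_linkReadingAtRuns_tuned K₀ jc sh 𝔯 G hβ1 hlink F θ hP hG hθ ht hγle halong os k hP4
  letI : DecidableEq (Σ K, SiteSeqKey F (K₀ + K)) := Classical.decEq _
  exact core_crOfRecord₁₃VAt K₀ (jc F θ hP g₀ os) sh θ hP g₀ os (core_nonneg_of_shellWeightBound hsh) hcore hsum

/-! ## §2 UNDER THE CRUX's PREFIX BY NAME, AT THE V READING -/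

/-- ★★ **N19′'s SLOT UNDER THE `ForSmallCouplings` PREFIX AT THE V READING, MODULO THE SHORTEST LINK READING SO FAR** [bookkeeping]: at every guarded admissible tuple
carrying K1⁷'s interval-form β-window `BetaBoundsInInterval D.C.toB12 γ₀ b b′` (N24's binder; HYPOTHESIS): FOR ALL SMALL COUPLINGS (threshold `min γ₀ θ.γ`, `g`-threshold
idle; `ForSmallCouplings` BY NAME) every `os k`: `PHolderD4 β D R → ∃ δ, NE7.Core S … δ ∧ Summable δ` at `S := crOfRecord₁₃VAt K₀ (jc F θ hP g₀ os) sh F θ hP g₀ os`.  (B) and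
`EndpointExistence` not used.  NOT NE7; N19 NOT discharged; NOT a proof of `stub_expansion13H`. -/
theorem forSmallCouplings_h19HolderD4_crOfRecord₁₃VAt_of_linkReadingAtRuns
    (F : T4Family) (θ : Stage13HParams F N) (hP : θ.Provisos₁₃CoPH F N) (hG : G θ) (hθ : θ.Admissible F N) {γ₀ b b' : ℝ} (hγ₀ : 0 < γ₀)
    (hβ : DagBinding.BetaBoundsInInterval (datumOfRecord₁₃CoPH F N θ hP).C.toB12 γ₀ b b') :
    ForSmallCouplings (datumOfRecord₁₃CoPH F N θ hP) fun g₀ => ∀ (os : List (ULoop F)) (k : ℕ),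
      (RatesHolderAt (datumOfRecord₁₃CoPH F N θ hP) (rateCarriersOfRecord₁₃CoPH 𝔯 F θ hP g₀ os k) β ∧
        ReadOutAt (datumOfRecord₁₃CoPH F N θ hP) (rateCarriersOfRecord₁₃CoPH 𝔯 F θ hP g₀ os k).u3 ∧
        (0 ≤ (rateCarriersOfRecord₁₃CoPH 𝔯 F θ hP g₀ os k).u3.ρ ∧ (rateCarriersOfRecord₁₃CoPH 𝔯 F θ hP g₀ os k).u3.ρ < 1)) →
      letI := (crOfRecord₁₃VAt K₀ (jc F θ hP g₀ os) sh F θ hP g₀ os).dec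
      ∃ δ : ℕ → ℝ, NE7.Core (crOfRecord₁₃VAt K₀ (jc F θ hP g₀ os) sh F θ hP g₀ os).l₀ (crOfRecord₁₃VAt K₀ (jc F θ hP g₀ os) sh F θ hP g₀ os).vol (crOfRecord₁₃VAt K₀ (jc F θ hP g₀ os) sh F θ hP g₀ os).T
        (crOfRecord₁₃VAt K₀ (jc F θ hP g₀ os) sh F θ hP g₀ os).Bad
        (fun K t τ => (crOfRecord₁₃VAt K₀ (jc F θ hP g₀ os) sh F θ hP g₀ os).A K t τ - (crOfRecord₁₃VAt K₀ (jc F θ hP g₀ os) sh F θ hP g₀ os).shA K t τ)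
        (fun K t τ => (crOfRecord₁₃VAt K₀ (jc F θ hP g₀ os) sh F θ hP g₀ os).B K t τ - (crOfRecord₁₃VAt K₀ (jc F θ hP g₀ os) sh F θ hP g₀ os).shB K t τ) δ ∧
        Summable δ := by
  refine ⟨min γ₀ θ.γ, lt_min hγ₀ hθ.toStage9.gamma_pos, fun γ _ hγle => ⟨1, one_pos, fun gIR _ _ g₀ ht os k hP4 => ?_⟩⟩
  exact h19HolderD4_crOfRecord₁₃VAt_of_linkReadingAtRuns_tuned K₀ jc sh 𝔯 G hβ1 hlink F θ hP hG hθ ht (hγle.trans (min_le_right _ _))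
    (fun K i hi => betaAlong_runFlow_le_of_betaBoundsInInterval _ hβ (hγle.trans (min_le_left _ _)) (ht K).1 i hi) os k hP4

/-- ★ **THE v2 SLOT TEXT AT THE V READING UNDER THE PREFIX** (`KeyedCoreEdgeHolderD4 β cr (rrOfRecord 𝔯 ks)`'s `g₀ os`-clause at `cr := fun F θ hP g₀ os =>
crOfRecord₁₃VAt K₀ (jc F θ hP g₀ os) sh F θ hP g₀ os`, unfolded, restricted to `ForSmallCouplings`; `K₀ := 0`, constant `jc` is K's `crOfRecord₁₃V jcut sh`): §2 at `k := ks F θ hP g₀ os` (`.mono`).  NOT a proof of stub 2. [folklore] -/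
theorem forSmallCouplings_keyedCoreEdgeHolderD4_crOfRecord₁₃VAt_of_linkReadingAtRuns
    (ks : (F : T4Family) → (θ : Stage13HParams F N) → θ.Provisos₁₃CoPH F N → (ℕ → ℝ) → List (ULoop F) → ℕ)
    (F : T4Family) (θ : Stage13HParams F N) (hP : θ.Provisos₁₃CoPH F N) (hG : G θ) (hθ : θ.Admissible F N) {γ₀ b b' : ℝ} (hγ₀ : 0 < γ₀)
    (hβ : DagBinding.BetaBoundsInInterval (datumOfRecord₁₃CoPH F N θ hP).C.toB12 γ₀ b b') :
    ForSmallCouplings (datumOfRecord₁₃CoPH F N θ hP) fun g₀ => ∀ (os : List (ULoop F)),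
      (RatesHolderAt (datumOfRecord₁₃CoPH F N θ hP) (rateCarriersOfRecord₁₃CoPH 𝔯 F θ hP g₀ os (ks F θ hP g₀ os)) β ∧
        ReadOutAt (datumOfRecord₁₃CoPH F N θ hP) (rateCarriersOfRecord₁₃CoPH 𝔯 F θ hP g₀ os (ks F θ hP g₀ os)).u3 ∧
        (0 ≤ (rateCarriersOfRecord₁₃CoPH 𝔯 F θ hP g₀ os (ks F θ hP g₀ os)).u3.ρ ∧
          (rateCarriersOfRecord₁₃CoPH 𝔯 F θ hP g₀ os (ks F θ hP g₀ os)).u3.ρ < 1)) →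
      letI := (crOfRecord₁₃VAt K₀ (jc F θ hP g₀ os) sh F θ hP g₀ os).dec
      ∃ δ : ℕ → ℝ, NE7.Core (crOfRecord₁₃VAt K₀ (jc F θ hP g₀ os) sh F θ hP g₀ os).l₀ (crOfRecord₁₃VAt K₀ (jc F θ hP g₀ os) sh F θ hP g₀ os).vol (crOfRecord₁₃VAt K₀ (jc F θ hP g₀ os) sh F θ hP g₀ os).T
        (crOfRecord₁₃VAt K₀ (jc F θ hP g₀ os) sh F θ hP g₀ os).Bad
        (fun K t τ => (crOfRecord₁₃VAt K₀ (jc F θ hP g₀ os) sh F θ hP g₀ os).A K t τ - (crOfRecord₁₃VAt K₀ (jc F θ hP g₀ os) sh F θ hP g₀ os).shA K t τ)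
        (fun K t τ => (crOfRecord₁₃VAt K₀ (jc F θ hP g₀ os) sh F θ hP g₀ os).B K t τ - (crOfRecord₁₃VAt K₀ (jc F θ hP g₀ os) sh F θ hP g₀ os).shB K t τ) δ ∧
        Summable δ :=
  (forSmallCouplings_h19HolderD4_crOfRecord₁₃VAt_of_linkReadingAtRuns K₀ jc sh 𝔯 G hβ1 hlink F θ hP hG hθ hγ₀ hβ).mono fun g₀ h os =>
    h os (ks F θ hP g₀ os)

end AtRunsV

end Summit.QuantumFields.YangMills.BalabanUVNodes.N19RateEdgeHolderD4AtRunsV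

end
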